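import Summits.AtomisticToContinuum.HydrodynamicLimit.Theorems.JaynesSqueezeSqueezeToBlockGibbsMeasurableRef
import Summits.AtomisticToContinuum.HydrodynamicLimit.Theorems.JaynesSqueezeSqueezeToBlockGibbsIntensity
import Summits.AtomisticToContinuum.HydrodynamicLimit.Theorems.JaynesSqueezeSqueezeToBlockGibbsUniformLDA

/-!
# The squeeze `SqueezeToBlockGibbs` (route JaynesSqueeze), VII: uniform local density approximation over block profiles

Helper file (`--supports stmt-AtomisticToContinuum-13463`) for the support item `SqueezeToBlockGibbs` of route
`JaynesSqueeze`. The pointwise local density approximation of the static input `HardSphereLDA` (B),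
`(N+1)⁻¹ log Z_pos(ρ e^{g(ρ)}) → ∫ ρ ψ(ρ)` for ONE measurable normalised density profile `ρ` with values in
`[r_lo, r_hi]`, is upgraded to a statement UNIFORM over all block-constant such profiles at a fixed scale `1/m`
(`uniform_blockLDA`): the block values `w : K → ℝ` (`K = range m ^ 3`) range over the compact set
`[r_lo, r_hi]^K ∩ {Σ m⁻³ w = 1}`, the maps `w ↦ (N+1)⁻¹ log Z_pos` are equi-Lipschitz through the continuous map
`w ↦ (log w_j + g(w_j))_j` (part IV, `abs_log_posPartition_sub_le`; positivity from part 0), and the limit `w ↦ Σ_j m⁻³ w_j ψ(w_j)` is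
continuous; part IV's abstract lemma `eventually_forall_abs_sub_le_of_tendsto` concludes. The block-constant
profile attached to `w` is written with the tree's block index `idx x = (⌊m · repr x i⌋₊)ᵢ` and the default value
`r_lo` off `K` (never attained).

References: Ruelle 1969 §3.4.
-/

noncomputable section

open MeasureTheory Filter Set Topology
open scoped ENNReal

namespace Summit.AtomisticToContinuum.HydrodynamicLimit.Theorems.JaynesSqueezeSqueeze

open Literature.MathematicalPhysics.KineticTheory Literature.Analysis.FluidPDE
open Literature.Analysis.FunctionSpaces

/-- Sums over the block index set `K = range m ^ 3` of a function extended by a default value off `K` are sums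
over the subtype `↥K`. [folklore] -/
theorem sum_blockExt_eq {m : ℕ} (w : ↥(Fintype.piFinset fun _ : Fin 3 => Finset.range m) → ℝ) (d : ℝ)
    (G : (Fin 3 → ℕ) → ℝ → ℝ) :
    ∑ k ∈ Fintype.piFinset (fun _ : Fin 3 => Finset.range m),
        G k (dite (k ∈ Fintype.piFinset fun _ : Fin 3 => Finset.range m) (fun h => w ⟨k, h⟩) (fun _ => d)) =
      ∑ j : ↥(Fintype.piFinset fun _ : Fin 3 => Finset.range m), G j (w j) := by
  rw [← Finset.sum_coe_sort]
  refine Finset.sum_congr rfl fun j _ => ?_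
  rw [dif_pos j.2]

/-- **Uniform local density approximation over block-constant profiles.** Let `σ ≤ 1/2`, `0 < m`,
`0 < r_lo ≤ r_hi`, `g, ψ` continuous on `[r_lo, r_hi]`, and assume the POINTWISE local density approximation for
every measurable normalised density profile with values in `[r_lo, r_hi]`:
`(N+1)⁻¹ log Z_pos(ρ e^{g(ρ)}; ε_N, N+1) → ∫ ρ ψ(ρ)`. Then for every `ε > 0`, eventually in `N`, SIMULTANEOUSLY
for all block values `w ∈ [r_lo, r_hi]^K` with `Σ_j m⁻³ w_j = 1`:
`|(N+1)⁻¹ log Z_pos(ρ_w e^{g(ρ_w)}) − Σ_j m⁻³ w_j ψ(w_j)| ≤ ε`, `ρ_w(x) = w_{idx x}`. [folklore] -/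
theorem uniform_blockLDA {σ : ℝ} (hσ2 : σ ≤ 1 / 2) {m : ℕ} (hm : 0 < m) (g ψ : ℝ → ℝ) {rlo rhi : ℝ}
    (hrlo : 0 < rlo) (hlohi : rlo ≤ rhi) (hgc : ContinuousOn g (Icc rlo rhi)) (hψc : ContinuousOn ψ (Icc rlo rhi))
    (hB : ∀ ρ₁ : T3 → ℝ, Measurable ρ₁ → (∀ x, rlo ≤ ρ₁ x ∧ ρ₁ x ≤ rhi) → ∫ x, ρ₁ x = 1 →
      Tendsto (fun N : ℕ => ((N : ℝ) + 1)⁻¹ *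
        Real.log (posPartition (fun x => ρ₁ x * Real.exp (g (ρ₁ x))) (hsDiameter σ N) (N + 1))) atTop
        (𝓝 (∫ x, ρ₁ x * ψ (ρ₁ x))))
    {ε : ℝ} (hε : 0 < ε) :
    ∀ᶠ N : ℕ in atTop, ∀ w : ↥(Fintype.piFinset fun _ : Fin 3 => Finset.range m) → ℝ,
      (∀ j, rlo ≤ w j ∧ w j ≤ rhi) → ∑ j, ((m : ℝ)⁻¹) ^ 3 * w j = 1 →
        |((N : ℝ) + 1)⁻¹ * Real.log (posPartition
            (fun x => (dite ((fun i => ⌊(m : ℝ) * Torus.repr x i⌋₊) ∈ Fintype.piFinset fun _ : Fin 3 => Finset.range m)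
                (fun h => w ⟨fun i => ⌊(m : ℝ) * Torus.repr x i⌋₊, h⟩) (fun _ => rlo)) *
              Real.exp (g (dite ((fun i => ⌊(m : ℝ) * Torus.repr x i⌋₊) ∈ Fintype.piFinset fun _ : Fin 3 => Finset.range m)
                (fun h => w ⟨fun i => ⌊(m : ℝ) * Torus.repr x i⌋₊, h⟩) (fun _ => rlo))))
            (hsDiameter σ N) (N + 1)) -
          ∑ j, ((m : ℝ)⁻¹) ^ 3 * (w j * ψ (w j))| ≤ ε := by
  set K := Fintype.piFinset (fun _ : Fin 3 => Finset.range m) with hK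
  -- the extension of block values to all indices, and the attached activity
  set R : (↥K → ℝ) → (Fin 3 → ℕ) → ℝ := fun w k => dite (k ∈ K) (fun h => w ⟨k, h⟩) (fun _ => rlo) with hR
  have hRmem : ∀ w (j : ↥K), R w j = w j := fun w j => by simp only [hR, dif_pos j.2]
  have hRval : ∀ w k, R w k = rlo ∨ ∃ j : ↥K, R w k = w j := by
    intro w k
    by_cases hk : k ∈ K
    · exact Or.inr ⟨⟨k, hk⟩, by simp only [hR, dif_pos hk]⟩
    · exact Or.inl (by simp only [hR, dif_neg hk])
  -- the compact parameter set
  set s : Set (↥K → ℝ) := {w | (∀ j, rlo ≤ w j ∧ w j ≤ rhi) ∧ ∑ j, ((m : ℝ)⁻¹) ^ 3 * w j = 1} with hs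
  have hs_cpt : IsCompact s := by
    have hcube : IsCompact (Set.pi univ fun _ : ↥K => Icc rlo rhi) := isCompact_univ_pi fun _ => isCompact_Icc
    have hclosed : IsClosed {w : ↥K → ℝ | ∑ j, ((m : ℝ)⁻¹) ^ 3 * w j = 1} :=
      isClosed_eq (continuous_finsetSum _ fun j _ => continuous_const.mul (continuous_apply j)) continuous_const
    have : s = (Set.pi univ fun _ : ↥K => Icc rlo rhi) ∩ {w | ∑ j, ((m : ℝ)⁻¹) ^ 3 * w j = 1} := by
      ext w
      simp only [hs, mem_setOf_eq, mem_inter_iff, Set.mem_pi, mem_univ, true_implies, mem_Icc]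
    rw [this]
    exact hcube.inter_right hclosed
  have hsb : ∀ w ∈ s, ∀ k, R w k ∈ Icc rlo rhi := by
    intro w hw k
    rcases hRval w k with h | ⟨j, h⟩
    · rw [h]; exact ⟨le_rfl, hlohi⟩
    · rw [h]; exact hw.1 j
  -- bounds for `g` on the range
  obtain ⟨gB, hgB⟩ := (isCompact_Icc (a := rlo) (b := rhi)).exists_bound_of_continuousOn hgc
  -- the three functions of the abstract lemma
  set f : ℕ → (↥K → ℝ) → ℝ := fun N w => ((N : ℝ) + 1)⁻¹ *
    Real.log (posPartition (fun x => R w (fun i => ⌊(m : ℝ) * Torus.repr x i⌋₊) *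
      Real.exp (g (R w (fun i => ⌊(m : ℝ) * Torus.repr x i⌋₊)))) (hsDiameter σ N) (N + 1)) with hf
  set Gl : (↥K → ℝ) → ℝ := fun w => ∑ j, ((m : ℝ)⁻¹) ^ 3 * (w j * ψ (w j)) with hGl
  set L : (↥K → ℝ) → (↥K → ℝ) := fun w j => Real.log (w j) + g (w j) with hL
  have hGlc : ContinuousOn Gl s := by
    refine continuousOn_finsetSum _ fun j _ => continuousOn_const.mul ?_
    have hproj : ContinuousOn (fun w : ↥K → ℝ => w j) s := (continuous_apply j).continuousOn
    have hmaps : MapsTo (fun w : ↥K → ℝ => w j) s (Icc rlo rhi) := fun w hw => hw.1 j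
    exact hproj.mul (hψc.comp hproj hmaps)
  have hLc : ContinuousOn L s := by
    refine continuousOn_pi.2 fun j => ?_
    have hproj : ContinuousOn (fun w : ↥K → ℝ => w j) s := (continuous_apply j).continuousOn
    have hmaps : MapsTo (fun w : ↥K → ℝ => w j) s (Icc rlo rhi) := fun w hw => hw.1 j
    refine (hproj.log fun w hw => (hrlo.trans_le (hw.1 j).1).ne').add (hgc.comp hproj hmaps)
  -- the activity attached to `w ∈ s`: measurable, positive, bounded
  have hact_m : ∀ w, Measurable fun x : T3 => R w (fun i => ⌊(m : ℝ) * Torus.repr x i⌋₊) *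
      Real.exp (g (R w (fun i => ⌊(m : ℝ) * Torus.repr x i⌋₊))) := by
    intro w
    have h1 : Measurable fun x : T3 => R w (fun i => ⌊(m : ℝ) * Torus.repr x i⌋₊) :=
      (measurable_of_countable (R w)).comp (measurable_blockIdx m)
    exact h1.mul (Real.measurable_exp.comp ((measurable_of_countable (g ∘ R w)).comp (measurable_blockIdx m)))
  have hact_pos : ∀ w ∈ s, ∀ x : T3, 0 < R w (fun i => ⌊(m : ℝ) * Torus.repr x i⌋₊) *
      Real.exp (g (R w (fun i => ⌊(m : ℝ) * Torus.repr x i⌋₊))) := fun w hw x =>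
    mul_pos (hrlo.trans_le (hsb w hw _).1) (Real.exp_pos _)
  have hact_le : ∀ w ∈ s, ∀ x : T3, R w (fun i => ⌊(m : ℝ) * Torus.repr x i⌋₊) *
      Real.exp (g (R w (fun i => ⌊(m : ℝ) * Torus.repr x i⌋₊))) ≤ rhi * Real.exp gB := by
    intro w hw x
    have hr := hsb w hw (fun i => ⌊(m : ℝ) * Torus.repr x i⌋₊)
    refine mul_le_mul hr.2 (Real.exp_le_exp.2 ((le_abs_self _).trans (hgB _ hr))) (Real.exp_pos _).le
      (hrlo.le.trans hlohi)
  have hact_lo : 0 < rlo * Real.exp (-gB) := mul_pos hrlo (Real.exp_pos _)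
  have hact_ge : ∀ w ∈ s, ∀ x : T3, rlo * Real.exp (-gB) ≤ R w (fun i => ⌊(m : ℝ) * Torus.repr x i⌋₊) *
      Real.exp (g (R w (fun i => ⌊(m : ℝ) * Torus.repr x i⌋₊))) := by
    intro w hw x
    have hr := hsb w hw (fun i => ⌊(m : ℝ) * Torus.repr x i⌋₊)
    exact mul_le_mul hr.1 (Real.exp_le_exp.2 (abs_le.1 (hgB _ hr)).1) (Real.exp_pos _).le (hrlo.le.trans hr.1)
  -- equi-Lipschitz through `L`
  have hlip : ∀ N, ∀ w ∈ s, ∀ w' ∈ s, |f N w - f N w'| ≤ dist (L w) (L w') := by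
    intro N w hw w' hw'
    have hD : ∀ x : T3, |Real.log (R w (fun i => ⌊(m : ℝ) * Torus.repr x i⌋₊) *
          Real.exp (g (R w (fun i => ⌊(m : ℝ) * Torus.repr x i⌋₊)))) -
        Real.log (R w' (fun i => ⌊(m : ℝ) * Torus.repr x i⌋₊) *
          Real.exp (g (R w' (fun i => ⌊(m : ℝ) * Torus.repr x i⌋₊))))| ≤ dist (L w) (L w') := by
      intro x
      set k : Fin 3 → ℕ := fun i => ⌊(m : ℝ) * Torus.repr x i⌋₊ with hk
      have hkK : k ∈ K := blockIdx_mem_piFinset hm x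
      have e1 : R w k = w ⟨k, hkK⟩ := by simp only [hR, dif_pos hkK]
      have e2 : R w' k = w' ⟨k, hkK⟩ := by simp only [hR, dif_pos hkK]
      rw [e1, e2, Real.log_mul (hrlo.trans_le (hw.1 _).1).ne' (Real.exp_pos _).ne', Real.log_exp,
        Real.log_mul (hrlo.trans_le (hw'.1 _).1).ne' (Real.exp_pos _).ne', Real.log_exp]
      have := dist_le_pi_dist (L w) (L w') ⟨k, hkK⟩
      rw [Real.dist_eq] at this
      exact this
    have hZ := posPartition_pos_of_bounds (hact_m w) hact_lo (fun x => ⟨hact_ge w hw x, hact_le w hw x⟩) hσ2 N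
    have hZ' := posPartition_pos_of_bounds (hact_m w') hact_lo (fun x => ⟨hact_ge w' hw' x, hact_le w' hw' x⟩) hσ2 N
    have h := abs_log_posPartition_sub_le (hact_m w) (hact_m w') (hact_pos w hw) (hact_pos w' hw')
      (hact_le w hw) (hact_le w' hw') hD (hsDiameter σ N) (N + 1) hZ hZ'
    simp only [hf]
    rw [← mul_sub, abs_mul, abs_of_pos (by positivity : (0 : ℝ) < ((N : ℝ) + 1)⁻¹)]
    calc ((N : ℝ) + 1)⁻¹ * |_| ≤ ((N : ℝ) + 1)⁻¹ * (((N + 1 : ℕ) : ℝ) * dist (L w) (L w')) :=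
          mul_le_mul_of_nonneg_left h (by positivity)
      _ = dist (L w) (L w') := by push_cast; field_simp
  -- pointwise convergence on `s`
  have hpt : ∀ w ∈ s, Tendsto (fun N => f N w) atTop (𝓝 (Gl w)) := by
    intro w hw
    have h1 : Measurable fun x : T3 => R w (fun i => ⌊(m : ℝ) * Torus.repr x i⌋₊) :=
      (measurable_of_countable (R w)).comp (measurable_blockIdx m)
    have h2 : ∀ x : T3, rlo ≤ R w (fun i => ⌊(m : ℝ) * Torus.repr x i⌋₊) ∧ R w (fun i => ⌊(m : ℝ) * Torus.repr x i⌋₊) ≤ rhi :=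
      fun x => hsb w hw _
    have h3 : ∫ x : T3, R w (fun i => ⌊(m : ℝ) * Torus.repr x i⌋₊) = 1 := by
      rw [integral_comp_blockIdx hm (R w), ← hw.2]
      exact sum_blockExt_eq w rlo fun _ r => ((m : ℝ)⁻¹) ^ 3 * r
    have h4 : ∫ x : T3, R w (fun i => ⌊(m : ℝ) * Torus.repr x i⌋₊) * ψ (R w (fun i => ⌊(m : ℝ) * Torus.repr x i⌋₊)) = Gl w := by
      rw [integral_comp_blockIdx hm (fun k => R w k * ψ (R w k))]
      exact sum_blockExt_eq w rlo fun _ r => ((m : ℝ)⁻¹) ^ 3 * (r * ψ r)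
    have h := hB _ h1 h2 h3
    rw [h4] at h
    exact h
  -- conclude with the abstract lemma
  have hmain := eventually_forall_abs_sub_le_of_tendsto hs_cpt hGlc hLc hlip hpt hε
  filter_upwards [hmain] with N hN w hw1 hw2
  exact hN w ⟨hw1, hw2⟩

end Summit.AtomisticToContinuum.HydrodynamicLimit.Theorems.JaynesSqueezeSqueeze

end
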